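import Literature.RingTheory.FittingIdeal.Basic
import Literature.RingTheory.FittingIdeal.Annihilator
import Literature.RingTheory.FittingIdeal.BaseChange
import Mathlib.RingTheory.Support
import Mathlib.RingTheory.Spectrum.Prime.Module
import Mathlib.RingTheory.Spectrum.Prime.RingHom
import Mathlib.RingTheory.Spectrum.Prime.Topology
import Mathlib.RingTheory.LocalRing.Module
import Mathlib.RingTheory.TensorProduct.Finite
import Mathlib.LinearAlgebra.TensorProduct.RightExactness
import Mathlib.LinearAlgebra.TensorProduct.Tower
import HarnessLib

/-!
# Support and vanishing of a finite module under base change (Eisenbud 20.7; Stacks 07ZA, 0BUR)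

Topic: `Literature/RingTheory/FittingIdeal`. For a finitely generated module `M` over a
commutative ring `R` and an arbitrary `R`-algebra `A`:

* `Module.pow_mem_fittingIdeal_zero_of_mem_annihilator`,
  `Module.annihilator_le_radical_fittingIdeal_zero`,
  `Module.radical_fittingIdeal_zero_eq` — the half `Ann(M)ⁿ ⊆ Fitt₀(M)` of Eisenbud, Prop. 20.7
  (`M` generated by `n` elements): for `a ∈ Ann(M)` the diagonal matrix `a·1ₙ` is a matrix of
  relations, so `aⁿ = det (a·1ₙ) ∈ Fitt₀(M)`; hence `√Fitt₀(M) = √Ann(M)`.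
* `Module.fittingIdeal_zero_eq_top_iff` — `Fitt₀(M) = R ↔ M = 0`.
* `Module.mem_support_iff_fittingIdeal_zero_le`, `Module.support_eq_zeroLocus_fittingIdeal_zero` —
  `Supp(M) = V(Fitt₀(M))` (Stacks 07ZA / 00L2).
* `Module.support_baseChange_eq` — **`Supp_A(A ⊗_R M) = (Spec A → Spec R)⁻¹ Supp_R(M)`**
  (Stacks 0BUR (1)); Mathlib has only the inclusion `⊆` (`Module.support_subset_preimage_comap`).
  Proof: Fitting ideals commute with base change (`Module.fittingIdeal_baseChange`, Stacks 07ZA (3)).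
* `Module.map_fittingIdeal_zero_eq_top_iff`, `Module.subsingleton_baseChange_iff` —
  **`A ⊗_R M = 0 ↔ Ann_R(M)·A = A`**.
* `LinearMap.surjective_baseChange_iff_subsingleton` (no finiteness),
  `LinearMap.surjective_baseChange_iff_map_annihilator_eq_top`,
  `LinearMap.surjective_baseChange_iff_range_comap_subset`,
  `LinearMap.surjective_baseChange_away_iff`,
  `LinearMap.surjective_baseChange_residueField_iff_notMem_support`,
  `LinearMap.isOpen_setOf_surjective_baseChange_residueField` — for `g : P → Q` linear with `Q`
  finite: `g ⊗ A` is onto iff `Ann_R(coker g)·A = A` iff `Spec A → Spec R` lands in the OPEN set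
  `D(Ann coker g) = (Supp coker g)ᶜ`; in particular surjectivity of `g ⊗ κ(𝔭)` is an open
  condition on `𝔭` ("the locus where finitely many given elements generate the fibre is open and
  represents the corresponding subfunctor" — the commutative algebra behind the standard open
  charts of Grassmannians / Quot schemes).

## Sources

* D. Eisenbud, *Commutative Algebra with a View Toward Algebraic Geometry*, GTM 150 (1995),
  Prop. 20.7, Cor. 20.5.
* The Stacks Project, Tags 07ZA (Fitting ideals: basics, base change), 00L2 (support of a
  finite module), 0BUR (support and base change), 01JJ (context: representability by open
  subfunctors).
* M. F. Atiyah, I. G. Macdonald, *Introduction to Commutative Algebra* (1969), Prop. 2.18,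
  Ch. 1 Ex. 21, Ch. 3 Ex. 19 (v), (viii).

Not here: Fitting ideals `Fitt_k` for `k > 0` under base change of the *locus* statements (the
rank-`k` loci `V(Fitt_{k-1}) ∖ V(Fitt_k)`), which follow the same pattern.
-/

namespace Literature.RingTheory.FittingIdeal

universe u v w

open TensorProduct PrimeSpectrum

variable {R : Type u} [CommRing R] {M : Type v} [AddCommGroup M] [Module R M]

/-! ## `Ann(M)ⁿ ⊆ Fitt₀(M) ⊆ Ann(M)` -/

/-- **Eisenbud Prop. 20.7 (generator-wise form)**: if `x₁, …, xₙ` generate `M` and `a` kills `M`,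
then `aⁿ ∈ Fitt₀(M)`: the diagonal matrix `a·1ₙ` consists of relations among the `xᵢ`, and its
determinant is `aⁿ`. [cite: Eisenbud1995, Prop. 20.7] -/
theorem Module.pow_mem_fittingIdeal_zero_of_mem_annihilator {n : ℕ} (x : Fin n → M)
    (hx : Submodule.span R (Set.range x) = ⊤) {a : R} (ha : a ∈ Module.annihilator R M) :
    a ^ n ∈ Module.fittingIdeal R M 0 := by
  classical
  have ha' : ∀ m : M, a • m = 0 := Module.mem_annihilator.mp ha
  -- the diagonal relation matrix `a · 1ₙ`
  have h := Module.det_mem_fittingIdeal (R := R) (M := M) (k := 0) (j := n) x hx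
    (fun i l => if l = i then a else 0) (fun i => by simp [ite_smul, ha'])
    (Function.Embedding.refl _)
  have hmat : (Matrix.of fun i i' : Fin n =>
      if (Function.Embedding.refl (Fin n)) i' = i then a else 0)
      = Matrix.diagonal fun _ : Fin n => a := by
    ext i i'
    simp only [Matrix.of_apply, Function.Embedding.refl_apply, Matrix.diagonal_apply, eq_comm]
  rw [hmat, Matrix.det_diagonal, Finset.prod_const, Finset.card_univ, Fintype.card_fin] at h
  exact h

/-- **Eisenbud Prop. 20.7**: for a finite module, `Ann(M) ⊆ √Fitt₀(M)` (indeed `Ann(M)ⁿ ⊆ Fitt₀(M)`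
for `M` generated by `n` elements). [cite: Eisenbud1995, Prop. 20.7] -/
theorem Module.annihilator_le_radical_fittingIdeal_zero [Module.Finite R M] :
    Module.annihilator R M ≤ (Module.fittingIdeal R M 0).radical := by
  obtain ⟨n, x, hx⟩ := Module.Finite.exists_fin (R := R) (M := M)
  intro a ha
  exact ⟨n, Module.pow_mem_fittingIdeal_zero_of_mem_annihilator x hx ha⟩

/-- **Eisenbud Prop. 20.7, radical form**: for a finite module `√Fitt₀(M) = √Ann(M)`, from
`Ann(M)ⁿ ⊆ Fitt₀(M) ⊆ Ann(M)`. [cite: Eisenbud1995, Prop. 20.7] -/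
theorem Module.radical_fittingIdeal_zero_eq [Module.Finite R M] :
    (Module.fittingIdeal R M 0).radical = (Module.annihilator R M).radical :=
  le_antisymm (Ideal.radical_mono Module.fittingIdeal_zero_le_annihilator)
    (Ideal.radical_le_radical_iff.mpr Module.annihilator_le_radical_fittingIdeal_zero)

/-- **`Fitt₀(M) = R ↔ M = 0`** (Stacks 07ZA: `Fitt₀(M) = R` iff `M` is generated by `0` elements).
No finiteness hypothesis. [cite: StacksProject, Tag 07ZA] -/
theorem Module.fittingIdeal_zero_eq_top_iff :
    Module.fittingIdeal R M 0 = ⊤ ↔ Subsingleton M := by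
  constructor
  · intro h
    exact (Module.annihilator_eq_top_iff (R := R) (M := M)).mp
      (top_le_iff.mp (h ▸ Module.fittingIdeal_zero_le_annihilator))
  · intro h
    refine Module.fittingIdeal_eq_top_of_span_eq_top (Fin.elim0 : Fin 0 → M) ?_
    exact Submodule.eq_top_iff'.mpr fun m => by
      rw [Subsingleton.elim m 0]
      exact Submodule.zero_mem _

/-! ## The support of a finite module is `V(Fitt₀)`; support commutes with base change -/

/-- For a finite module and a prime `𝔭`: `𝔭 ∈ Supp(M) ↔ Fitt₀(M) ⊆ 𝔭` (Stacks 07ZA with 00L2: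
`Supp(M) = V(Ann M)` and `√Fitt₀ = √Ann`). [cite: StacksProject, Tag 07ZA] -/
theorem Module.mem_support_iff_fittingIdeal_zero_le [Module.Finite R M] (p : PrimeSpectrum R) :
    p ∈ Module.support R M ↔ Module.fittingIdeal R M 0 ≤ p.asIdeal := by
  rw [Module.mem_support_iff_of_finite]
  constructor
  · exact fun h => Module.fittingIdeal_zero_le_annihilator.trans h
  · intro h
    exact Module.annihilator_le_radical_fittingIdeal_zero.trans (p.isPrime.radical_le_iff.mpr h)

/-- For a finite module, **`Supp(M) = V(Fitt₀(M))`** as subsets of `Spec R`.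
[cite: StacksProject, Tag 07ZA] -/
theorem Module.support_eq_zeroLocus_fittingIdeal_zero [Module.Finite R M] :
    Module.support R M = zeroLocus (Module.fittingIdeal R M 0 : Set R) := by
  ext p
  rw [Module.mem_support_iff_fittingIdeal_zero_le, mem_zeroLocus, SetLike.coe_subset_coe]

section BaseChange

variable (A : Type w) [CommRing A] [Algebra R A]

/-- **Support commutes with base change for finite modules** (Stacks 0BUR (1)): for a finite
`R`-module `M` and any `R`-algebra `A`, `Supp_A(A ⊗_R M)` is the preimage of `Supp_R(M)` under
`Spec A → Spec R` (Atiyah–Macdonald Ch. 3, Ex. 19 (viii)). Mathlib's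
`Module.support_subset_preimage_comap` is the inclusion `⊆`; the equality is the TODO
"stacks#0BUR" of `Mathlib/RingTheory/Support.lean`. Proof: both sides are `V(Fitt₀(M)·A)` since
Fitting ideals commute with base change. [cite: StacksProject, Tag 0BUR] -/
theorem Module.support_baseChange_eq [Module.Finite R M] :
    Module.support A (A ⊗[R] M) = comap (algebraMap R A) ⁻¹' Module.support R M := by
  rw [Module.support_eq_zeroLocus_fittingIdeal_zero, Module.support_eq_zeroLocus_fittingIdeal_zero,
    preimage_comap_zeroLocus, Module.fittingIdeal_baseChange A 0, Ideal.map, zeroLocus_span]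

/-- For a finite module and a ring map `R → A`: `Fitt₀(M)·A = A ↔ Ann(M)·A = A` (the two ideals
have the same radical, Eisenbud Prop. 20.7). [cite: Eisenbud1995, Prop. 20.7] -/
theorem Module.map_fittingIdeal_zero_eq_top_iff [Module.Finite R M] :
    (Module.fittingIdeal R M 0).map (algebraMap R A) = ⊤ ↔
      (Module.annihilator R M).map (algebraMap R A) = ⊤ := by
  constructor
  · intro h
    exact top_le_iff.mp (h ▸ Ideal.map_mono Module.fittingIdeal_zero_le_annihilator)
  · intro h
    rw [← Ideal.radical_eq_top]
    refine top_le_iff.mp ?_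
    calc (⊤ : Ideal A) = (Module.annihilator R M).map (algebraMap R A) := h.symm
      _ ≤ ((Module.fittingIdeal R M 0).radical).map (algebraMap R A) :=
          Ideal.map_mono Module.annihilator_le_radical_fittingIdeal_zero
      _ ≤ ((Module.fittingIdeal R M 0).map (algebraMap R A)).radical := Ideal.map_radical_le _

/-- **Vanishing of a finite module after base change**: for a finite `R`-module `M` and any
`R`-algebra `A`, `A ⊗_R M = 0 ↔ Ann_R(M)·A = A` (Stacks 07ZA (3) with Eisenbud Prop. 20.7:
`A ⊗ M = 0 ↔ Fitt₀(A ⊗ M) = Fitt₀(M)·A = A`). [cite: StacksProject, Tag 07ZA] -/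
theorem Module.subsingleton_baseChange_iff [Module.Finite R M] :
    Subsingleton (A ⊗[R] M) ↔ (Module.annihilator R M).map (algebraMap R A) = ⊤ := by
  rw [← Module.map_fittingIdeal_zero_eq_top_iff, ← Module.fittingIdeal_baseChange A 0,
    Module.fittingIdeal_zero_eq_top_iff]

end BaseChange

/-! ## Surjectivity of a linear map after base change -/

section Surjective

variable {P : Type*} {Q : Type*} [AddCommGroup P] [Module R P] [AddCommGroup Q] [Module R Q]
  (g : P →ₗ[R] Q) (A : Type w) [CommRing A] [Algebra R A]

/-- **Right exactness of `A ⊗_R -`** (Atiyah–Macdonald Prop. 2.18): `g ⊗ A : A ⊗ P → A ⊗ Q` is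
onto iff `A ⊗_R coker(g) = 0` (`A ⊗ P → A ⊗ Q → A ⊗ coker g → 0` is exact). No finiteness
hypothesis; universe-polymorphic in `R`, `P`, `Q`, `A` (the single-universe form is
`Literature.Algebra.Module.surjective_baseChange_iff_subsingleton_tensor_coker`).
[cite: AtiyahMacdonald1969, Prop. 2.18] -/
theorem LinearMap.surjective_baseChange_iff_subsingleton :
    Function.Surjective (g.baseChange A) ↔ Subsingleton (A ⊗[R] (Q ⧸ LinearMap.range g)) := by
  have hex : Function.Exact (g.lTensor A) ((LinearMap.range g).mkQ.lTensor A) :=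
    lTensor_exact A (LinearMap.exact_map_mkQ_range g) (Submodule.mkQ_surjective _)
  have hsurj : Function.Surjective ((LinearMap.range g).mkQ.lTensor A) :=
    LinearMap.lTensor_surjective A (Submodule.mkQ_surjective _)
  rw [LinearMap.baseChange_eq_ltensor]
  constructor
  · intro h
    refine ⟨fun z w => ?_⟩
    obtain ⟨y, rfl⟩ := hsurj z
    obtain ⟨y', rfl⟩ := hsurj w
    have hy : y - y' ∈ LinearMap.ker ((LinearMap.range g).mkQ.lTensor A) := by
      rw [hex.linearMap_ker_eq, LinearMap.range_eq_top.mpr h]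
      exact Submodule.mem_top
    rwa [LinearMap.mem_ker, map_sub, sub_eq_zero] at hy
  · intro h x
    have hx : x ∈ LinearMap.range (g.lTensor A) := by
      rw [← hex.linearMap_ker_eq, LinearMap.mem_ker]
      exact Subsingleton.elim _ _
    exact hx

/-- **Surjectivity after base change, ideal-theoretic criterion**: for `g : P → Q` linear with `Q`
finite over `R` and any `R`-algebra `A`, `g ⊗ A` is onto iff `Ann_R(coker g)·A = A`.
[cite: StacksProject, Tag 07ZA] -/
theorem LinearMap.surjective_baseChange_iff_map_annihilator_eq_top [Module.Finite R Q] :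
    Function.Surjective (g.baseChange A) ↔
      (Module.annihilator R (Q ⧸ LinearMap.range g)).map (algebraMap R A) = ⊤ := by
  rw [LinearMap.surjective_baseChange_iff_subsingleton, Module.subsingleton_baseChange_iff]

/-- The same criterion with the Fitting ideal of the cokernel (whose generators are the maximal
minors of a presentation — the Plücker-type equations of the locus): `g ⊗ A` is onto iff
`Fitt₀(coker g)·A = A`. [cite: StacksProject, Tag 07ZA] -/
theorem LinearMap.surjective_baseChange_iff_map_fittingIdeal_eq_top [Module.Finite R Q] :
    Function.Surjective (g.baseChange A) ↔
      (Module.fittingIdeal R (Q ⧸ LinearMap.range g) 0).map (algebraMap R A) = ⊤ := by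
  rw [LinearMap.surjective_baseChange_iff_map_annihilator_eq_top,
    Module.map_fittingIdeal_zero_eq_top_iff]

omit [Algebra R A] in
/-- `I·A = A` iff the image of `Spec A → Spec R` avoids `V(I)`, i.e. lies in the open set `D(I)`
(Atiyah–Macdonald Ch. 1, Ex. 21 (ii): `φ*⁻¹(V(𝔞)) = V(𝔞ᵉ)`, empty iff `𝔞ᵉ = (1)`).
[cite: AtiyahMacdonald1969, Ch. 1 Ex. 21 (ii)] -/
theorem Ideal.map_eq_top_iff_range_comap_subset_compl_zeroLocus (f : R →+* A) (I : Ideal R) :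
    I.map f = ⊤ ↔ Set.range (comap f) ⊆ (zeroLocus (I : Set R))ᶜ := by
  rw [← zeroLocus_empty_iff_eq_top, Ideal.map, zeroLocus_span, ← preimage_comap_zeroLocus,
    Set.preimage_eq_empty_iff, Set.subset_compl_iff_disjoint_left]

/-- **Surjectivity after base change is representable by an open subscheme**: for `g : P → Q`
linear with `Q` finite over `R` and any `R`-algebra `A`, `g ⊗ A` is onto iff `Spec A → Spec R`
factors (set-theoretically, hence scheme-theoretically, `D(I)` being open) through the open
subset `D(Ann_R coker g) = (Supp coker g)ᶜ` of `Spec R`. [cite: StacksProject, Tag 01JJ] -/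
theorem LinearMap.surjective_baseChange_iff_range_comap_subset [Module.Finite R Q] :
    Function.Surjective (g.baseChange A) ↔
      Set.range (comap (algebraMap R A)) ⊆ (Module.support R (Q ⧸ LinearMap.range g))ᶜ := by
  rw [LinearMap.surjective_baseChange_iff_map_annihilator_eq_top,
    Ideal.map_eq_top_iff_range_comap_subset_compl_zeroLocus, Module.support_eq_zeroLocus]

/-- The basic-open form: for `r : R`, `g ⊗ R[1/r]` is onto iff `D(r) ⊆ (Supp coker g)ᶜ`.
[cite: StacksProject, Tag 01JJ] -/
theorem LinearMap.surjective_baseChange_away_iff [Module.Finite R Q] (r : R)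
    [IsLocalization.Away r A] :
    Function.Surjective (g.baseChange A) ↔
      (basicOpen r : Set (PrimeSpectrum R)) ⊆ (Module.support R (Q ⧸ LinearMap.range g))ᶜ := by
  rw [LinearMap.surjective_baseChange_iff_range_comap_subset, localization_away_comap_range A r]

/-- The pointwise form: for a prime `𝔭`, `g ⊗ κ(𝔭)` is onto iff `𝔭 ∉ Supp(coker g)` (Nakayama:
`κ(𝔭) ⊗ C = 0 ↔ C_𝔭 = 0` for `C` finite, Mathlib
`Module.mem_support_iff_nontrivial_residueField_tensorProduct`); universe-polymorphic form of
`Literature.Algebra.Module.surjective_baseChange_residueField_iff`.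
[cite: AtiyahMacdonald1969, Ch. 3 Ex. 19 (viii)] -/
theorem LinearMap.surjective_baseChange_residueField_iff_notMem_support [Module.Finite R Q]
    (p : PrimeSpectrum R) :
    Function.Surjective (g.baseChange p.asIdeal.ResidueField) ↔
      p ∉ Module.support R (Q ⧸ LinearMap.range g) := by
  rw [LinearMap.surjective_baseChange_iff_subsingleton,
    Module.mem_support_iff_nontrivial_residueField_tensorProduct, not_nontrivial_iff_subsingleton]

/-- **Openness of the surjectivity locus**: for `g : P → Q` linear with `Q` finite, the set of
primes `𝔭` at which `g ⊗ κ(𝔭)` is onto is the open set `(Supp coker g)ᶜ = D(Ann coker g)`.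
[cite: StacksProject, Tag 01JJ] -/
theorem LinearMap.setOf_surjective_baseChange_residueField_eq [Module.Finite R Q] :
    {p : PrimeSpectrum R | Function.Surjective (g.baseChange p.asIdeal.ResidueField)} =
      (Module.support R (Q ⧸ LinearMap.range g))ᶜ := by
  ext p
  exact LinearMap.surjective_baseChange_residueField_iff_notMem_support g p

/-- The surjectivity locus `{𝔭 | g ⊗ κ(𝔭) onto}` of a linear map to a finite module is open in
`Spec R`. [cite: StacksProject, Tag 01JJ] -/
theorem LinearMap.isOpen_setOf_surjective_baseChange_residueField [Module.Finite R Q] :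
    IsOpen {p : PrimeSpectrum R | Function.Surjective (g.baseChange p.asIdeal.ResidueField)} := by
  rw [LinearMap.setOf_surjective_baseChange_residueField_eq]
  exact (Module.isClosed_support (R := R) (M := Q ⧸ LinearMap.range g)).isOpen_compl

end Surjective

end Literature.RingTheory.FittingIdeal
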